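import Mathlib
import Literature.Analysis.FluidPDE.TypeIAncientMild
import Literature.Analysis.FluidPDE.OseenSlice
import Literature.Analysis.FluidPDE.OseenKernelBasis
import Literature.Analysis.FluidPDE.KochTataruKernel
import Literature.Analysis.FluidPDE.MildSolutionProofs
import Literature.Analysis.UnboundedOperators.HeatKernelBoundedData
import Literature.Analysis.UnboundedOperators.HeatExtensionDecay
import Summits.NavierStokesRegularity.NavierStokesRegularity.Theorems.SymmetryModuliCountSymmetricLiouvilleSmallAtMinusInfinity
import Summits.NavierStokesRegularity.NavierStokesRegularity.Theorems.DssFarFieldSlavingBlowupTypeIDssProfileSimilarityEnstrophyTimeOnlyThreshold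
import HarnessLib
import Summits.NavierStokesRegularity.NavierStokesRegularity.Theorems.ScenarioCensusRoughnessMeter
import Summits.NavierStokesRegularity.NavierStokesRegularity.Theorems.ScenarioCensusDiffusionMeterRows

/-!
# Census block A2 (amplitude meters), cells A2da / A2d1 / A2d0 / A2db / A2dv (DECIDED), A2dn / A2dl (OPEN) — instrument «DEVIATOR METER», LINE «deviator-meter» rev 2 port,
# part 1/4: the instrument — the coarse-grained deviatoric Reynolds stress (§A), constants (§B; the kernel constant taken BY NAME from the roughness-meter port), THE LEVER:
# the Oseen kernel is trace-free in its tensor slot (§C)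

Re-homed for the scenario census (typer seat ns-census-typer-1 g8; cells of ns-idea-2 g14 LINE g14-4 «deviator-meter», rev 2 528544c56f6257b6 = rev 1 + one nesting (ref
ns-census-ref §15.23 / §15.27 ✓, critic idea-crit-3 PASS — no price), members of block A2 booked by the lead since census v1.79 / v1.80; this port makes the decided cells
TREE-decided): VERBATIM PORT of `pub/ideators/ns-idea-2/lines/deviator-meter/line-deviator-meter.rev2.lean` sha16 528544c56f6257b6 (1325 l., lean check rc 0, 0 sorry), split
for the 400-line rule into `ScenarioCensusDeviatorMeter` (§A–§C) → `…DeviatorMeterStress` (§D–§E) → `…DeviatorMeterEngine` (§F–§G) → `…DeviatorMeterRows` (§H–§J + census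
KEYS).  Lean text VERBATIM in namespace `…Theorems.ScenarioCensus.DeviatorMeter` (the line's `…Lines.DeviatorMeter` re-homed); port edits: `local notation "E3"` →
`abbrev E3` (typer lint: no notation in port files), `@[conjecture]` on the OPEN rows `Row_A2dn` / `Row_A2dl` (typed only), one-line docstrings added where missing (gate lint);
lemmas and the constant `kernelConst` that the line shares VERBATIM with the landed roughness-meter / diffusion-meter ports are taken BY NAME (listed below).  Statements
untouched.

No census VALUE is moved here (the cells become TREE-decided by name; booking is the lead's); NS regularity is NOT proved; (L′) ⟨10661⟩ is untouched; no summit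
statement is proved by this file. Lemmas that restate already-landed tree declarations are taken BY NAME (gate lint `dedup.landed`): `kernelConst` = `RoughnessMeter.kernelConst`, `kernelConst_pos` = `RoughnessMeter.kernelConst_pos`, `kernelConst_spec` = `RoughnessMeter.kernelConst_spec`, `integrableOn_sub_rpow` = `RoughnessMeter.integrableOn_sub_rpow`, `setIntegral_sub_rpow` = `RoughnessMeter.setIntegral_sub_rpow`, `eq_zero_of_small_backward_end` = `DiffusionMeter.eq_zero_of_small_backward_end`.
-/

-- the summit and its single problem share the name `NavierStokesRegularity` (D-0017 nested layout)
set_option linter.dupNamespace false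

noncomputable section

open Set Function Filter Topology Metric MeasureTheory
open scoped RealInnerProductSpace

namespace Summit.NavierStokesRegularity.NavierStokesRegularity.Theorems.ScenarioCensus.DeviatorMeter

open Literature.Analysis Literature.Analysis.FluidPDE
open Summit.NavierStokesRegularity.NavierStokesRegularity.Theorems.SimilarityEnstrophy
  (typeI_ancient_eq_zero_of_rate_lt_one)
open Summit.NavierStokesRegularity.NavierStokesRegularity.Theorems.SymmetryModuliCountSymmetricLiouville
  (vanishes_of_vanishes_before)

/-- `ℝ³` (the line's `local notation "E3"`, spelled as a reducible abbreviation for the tree). -/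
abbrev E3 := EuclideanSpace ℝ (Fin 3)

/-! ## A. The instrument: the coarse-grained deviatoric Reynolds stress -/

/-- The standard orthonormal frame `e₀, e₁, e₂` of `ℝ³`. -/
def frame : OrthonormalBasis (Fin 3) ℝ E3 := EuclideanSpace.basisFun (Fin 3) ℝ

/-- The frame vectors are unit vectors. -/
theorem norm_frame (j : Fin 3) : ‖frame j‖ = 1 := frame.orthonormal.1 j

/-- `|⟪v, frame j⟫| ≤ ‖v‖`. -/
theorem abs_inner_frame_le (v : E3) (j : Fin 3) : |⟪v, frame j⟫| ≤ ‖v‖ := by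
  have h := abs_real_inner_le_norm v (frame j)
  rwa [norm_frame, mul_one] at h

/-- The pointwise Reynolds stress of a slice `f`: `(f ⊗ f)ⱼₖ(z) = fⱼ(z) fₖ(z)`. -/
def stressFun (f : E3 → E3) (j k : Fin 3) : E3 → ℝ := fun z => ⟪f z, frame j⟫ * ⟪f z, frame k⟫

/-- The pointwise DEVIATORIC (trace-free) stress `fⱼ fₖ - δⱼₖ ‖f‖²/3`. -/
def devFun (f : E3 → E3) (j k : Fin 3) : E3 → ℝ :=
  fun z => ⟪f z, frame j⟫ * ⟪f z, frame k⟫ - if j = k then ‖f z‖ ^ 2 / 3 else 0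

/-- **THE INSTRUMENT.**  The coarse-grained deviatoric Reynolds stress of a space-time field `u`
at time `τ`, heat scale `s > 0`, entry `(j, k)`, point `y`:
`D[u](τ, s)ⱼₖ(y) = e^{sΔ}(uⱼuₖ - δⱼₖ|u|²/3)(τ, y) = (e^{sΔ}(u ⊗ u) - ⅓ tr(e^{sΔ}(u ⊗ u)) I)ⱼₖ(τ, y)`
(the Gauss–Weierstrass average at length `√s` of the traceless part of the momentum flux). -/
def devStress (u : ℝ → E3 → E3) (τ s : ℝ) (j k : Fin 3) : E3 → ℝ :=
  UnboundedOperators.heatExtension (devFun (u τ) j k) s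

/-- `stressFun` of a continuous field is continuous. -/
theorem continuous_stressFun {f : E3 → E3} (hf : Continuous f) (j k : Fin 3) :
    Continuous (stressFun f j k) :=
  (hf.inner continuous_const).mul (hf.inner continuous_const)

/-- `devFun` of a continuous field is continuous. -/
theorem continuous_devFun {f : E3 → E3} (hf : Continuous f) (j k : Fin 3) :
    Continuous (devFun f j k) := by
  unfold devFun
  refine ((hf.inner continuous_const).mul (hf.inner continuous_const)).sub ?_
  split_ifs
  · exact (hf.norm.pow 2).div_const 3
  · exact continuous_const

/-- Elementary bound `‖v‖² ≤ …` used by the stress estimates. -/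
theorem norm_sq_le_mul {f : E3 → E3} {M M' : ℝ} (hM : ∀ z, ‖f z‖ ≤ M) (hM' : ∀ z, ‖f z‖ ≤ M')
    (z : E3) : ‖f z‖ ^ 2 ≤ M * M' := by
  rw [sq]
  exact mul_le_mul (hM z) (hM' z) (norm_nonneg _) ((norm_nonneg _).trans (hM z))

/-- `|stressFun f j k| ≤ ‖f‖²` pointwise. -/
theorem abs_stressFun_le {f : E3 → E3} {M M' : ℝ} (hM : ∀ z, ‖f z‖ ≤ M) (hM' : ∀ z, ‖f z‖ ≤ M')
    (j k : Fin 3) (z : E3) : |stressFun f j k z| ≤ M * M' := by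
  unfold stressFun
  rw [abs_mul]
  exact mul_le_mul ((abs_inner_frame_le _ _).trans (hM z)) ((abs_inner_frame_le _ _).trans (hM' z))
    (abs_nonneg _) ((norm_nonneg _).trans (hM z))

/-- `|(f ⊗ f - ⅓|f|² I)ⱼₖ| ≤ ‖f‖²` pointwise. -/
theorem abs_devFun_le_norm_sq (f : E3 → E3) (j k : Fin 3) (z : E3) : |devFun f j k z| ≤ ‖f z‖ ^ 2 := by
  unfold devFun
  have hj := abs_inner_frame_le (f z) j
  have hk := abs_inner_frame_le (f z) k
  split_ifs with hjk
  · subst hjk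
    have h1 : ⟪f z, frame j⟫ * ⟪f z, frame j⟫ ≤ ‖f z‖ ^ 2 := by
      rw [← abs_mul_abs_self, sq]
      exact mul_le_mul hj hj (abs_nonneg _) (norm_nonneg _)
    have h2 : 0 ≤ ⟪f z, frame j⟫ * ⟪f z, frame j⟫ := mul_self_nonneg _
    rw [abs_le]
    constructor <;> nlinarith [sq_nonneg ‖f z‖]
  · rw [sub_zero, abs_mul, sq]
    exact mul_le_mul hj hk (abs_nonneg _) (norm_nonneg _)

/-- Pointwise bound on the deviatoric stress function. -/
theorem abs_devFun_le {f : E3 → E3} {M M' : ℝ} (hM : ∀ z, ‖f z‖ ≤ M) (hM' : ∀ z, ‖f z‖ ≤ M')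
    (j k : Fin 3) (z : E3) : |devFun f j k z| ≤ M * M' :=
  (abs_devFun_le_norm_sq f j k z).trans (norm_sq_le_mul hM hM' z)

/-- **Free region of the meter.**  For a Type-I ancient mild field the instrument is ALWAYS
bounded by `C²/(-τ)` (heat averages do not increase sup norms): a hypothesis
`|D[u](τ,s)| ≤ ε(τ,s)` is automatic wherever `ε(τ,s) ≥ C²/(-τ)`. -/
theorem abs_devStress_le_typeI {C : ℝ} {u : ℝ → E3 → E3} (hu : IsTypeIAncientMild C u)
    {τ : ℝ} (hτ : τ < 0) {s : ℝ} (hs : 0 < s) (j k : Fin 3) (y : E3) :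
    |devStress u τ s j k y| ≤ C * C / (-τ) := by
  have hb : ∀ z, ‖devFun (u τ) j k z‖ ≤ C / Real.sqrt (-τ) * (C / Real.sqrt (-τ)) := fun z => by
    rw [Real.norm_eq_abs]
    exact abs_devFun_le (fun z => hu.norm_le hτ z) (fun z => hu.norm_le hτ z) j k z
  have h := UnboundedOperators.norm_heatExtension_le_of_bound hb hs y
  rw [Real.norm_eq_abs] at h
  refine h.trans (le_of_eq ?_)
  have hsq : Real.sqrt (-τ) * Real.sqrt (-τ) = -τ := Real.mul_self_sqrt (by linarith)
  rw [div_mul_div_comm, hsq]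

/-- Amplitude form of the free bound: if `√(-τ)‖u(τ,·)‖ ≤ M` and `u ∈ A_C` then
`|D[u](τ,s)| ≤ M C/(-τ)`. -/
theorem abs_devStress_le_amp {C : ℝ} {u : ℝ → E3 → E3} (hu : IsTypeIAncientMild C u)
    {τ : ℝ} (hτ : τ < 0) {M : ℝ} (hM : ∀ y, Real.sqrt (-τ) * ‖u τ y‖ ≤ M) {s : ℝ} (hs : 0 < s)
    (j k : Fin 3) (y : E3) : |devStress u τ s j k y| ≤ M * C / (-τ) := by
  have hs0 : 0 < Real.sqrt (-τ) := Real.sqrt_pos.2 (by linarith)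
  have hM' : ∀ z, ‖u τ z‖ ≤ M / Real.sqrt (-τ) := fun z => by
    rw [le_div_iff₀ hs0, mul_comm]; exact hM z
  have hb : ∀ z, ‖devFun (u τ) j k z‖ ≤ M / Real.sqrt (-τ) * (C / Real.sqrt (-τ)) := fun z => by
    rw [Real.norm_eq_abs]
    exact abs_devFun_le hM' (fun z => hu.norm_le hτ z) j k z
  have h := UnboundedOperators.norm_heatExtension_le_of_bound hb hs y
  rw [Real.norm_eq_abs] at h
  refine h.trans (le_of_eq ?_)
  have hsq : Real.sqrt (-τ) * Real.sqrt (-τ) = -τ := Real.mul_self_sqrt (by linarith)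
  rw [div_mul_div_comm, hsq]

/-- **Semigroup covariance of the meter**: `D[u](τ, s') = e^{(s'-s)Δ} D[u](τ, s)` for
`0 < s < s'` (the deviator commutes with the heat flow). -/
theorem devStress_semigroup {C : ℝ} {u : ℝ → E3 → E3} (hu : IsTypeIAncientMild C u) {τ : ℝ}
    (hτ : τ < 0) {s s' : ℝ} (hs : 0 < s) (hss' : s < s') (j k : Fin 3) :
    devStress u τ s' j k = UnboundedOperators.heatExtension (devStress u τ s j k) (s' - s) := by
  have hmem : MemLp (devFun (u τ) j k) ⊤ volume :=
    UnboundedOperators.memLp_top_of_continuous_of_bound (continuous_devFun (hu.continuous_slice hτ) j k)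
      (C := C / Real.sqrt (-τ) * (C / Real.sqrt (-τ))) fun z => by
        rw [Real.norm_eq_abs]
        exact abs_devFun_le (fun z => hu.norm_le hτ z) (fun z => hu.norm_le hτ z) j k z
  have h := UnboundedOperators.heatExtension_add_holds hmem le_top hs (by linarith : 0 < s' - s)
  simp only [devStress]
  rw [h, show s + (s' - s) = s' by ring]

/-- **Monotonicity in the scale**: an entrywise bound on the meter at scale `s` persists at every
larger scale `s' ≥ s` (maximum principle for the heat flow). -/
theorem abs_devStress_mono {C : ℝ} {u : ℝ → E3 → E3} (hu : IsTypeIAncientMild C u) {τ : ℝ}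
    (hτ : τ < 0) {s s' : ℝ} (hs : 0 < s) (hss' : s ≤ s') {j k : Fin 3} {B : ℝ}
    (hB : ∀ y, |devStress u τ s j k y| ≤ B) (y : E3) : |devStress u τ s' j k y| ≤ B := by
  rcases eq_or_lt_of_le hss' with h | h
  · rw [← h]; exact hB y
  · rw [devStress_semigroup hu hτ hs h j k]
    have hb' : ∀ z, ‖devStress u τ s j k z‖ ≤ B := fun z => by rw [Real.norm_eq_abs]; exact hB z
    have := UnboundedOperators.norm_heatExtension_le_of_bound hb' (by linarith : 0 < s' - s) y
    rwa [Real.norm_eq_abs] at this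

/-! ## B. Constants: the kernel constant and the kernel mass -/

-- `kernel_bound_three`: the kernel bound is used only through `kernelConst` (taken BY NAME from the roughness-meter port, where it is the Literature lemma `exists_norm_oseenKernel_three_le`); not re-declared.

-- `kernelConst`: the line restates the tree's `RoughnessMeter.kernelConst`; taken BY NAME (gate lint dedup.landed).

-- `kernelConst_pos`: the line restates the tree's `RoughnessMeter.kernelConst_pos`; taken BY NAME (gate lint dedup.landed).

-- `kernelConst_spec`: the line restates the tree's `RoughnessMeter.kernelConst_spec`; taken BY NAME (gate lint dedup.landed).

/-- The **kernel mass** `I = ∫_{ℝ³} (1 + ‖w‖²)^{-2} dw` (`= π²`). -/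
def kernelMass : ℝ := ∫ w : E3, (1 + ‖w‖ ^ 2) ^ (-(2 : ℝ))

/-- The kernel mass is positive. -/
theorem kernelMass_pos : 0 < kernelMass := by
  unfold kernelMass
  refine integral_one_add_norm_sq_rpow_neg_pos (E := E3) ?_
  rw [finrank_euclideanSpace_fin]; norm_num

/-- `CI = C_K · I`, the one constant of the engine. -/
def CI : ℝ := RoughnessMeter.kernelConst * kernelMass

/-- `0 < CI`. -/
theorem CI_pos : 0 < CI := mul_pos RoughnessMeter.kernelConst_pos kernelMass_pos

/-! ## C. THE LEVER: the Oseen kernel is trace-free in its tensor slot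

`∑ᵢ K(τ, z)[eᵢ, eᵢ] = 0` for every orthonormal frame: the kernel of `e^{τΔ}P∇·` annihilates
ISOTROPIC tensor fields `p(y)·I` — `P∇·(pI) = P∇p = 0` — exactly as it annihilates constant
tensors (KNSS 2009, Remark 6.1).  At the level of Koch–Tataru's explicit kernel
`K[a,b] = -(⟪z,a⟫/2τ) G_τ b + A (⟪z,a⟫ b + ⟪a,b⟫ z + ⟪z,b⟫ a) - B ⟪z,a⟫⟪z,b⟫ z` this is the weight
identity `(d+2) A(τ,z) - ‖z‖² B(τ,z) = G_τ(z)/(2τ)`, an integration by parts in the Gaussian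
subordination variable. -/

section Lever

variable {E : Type*} [NormedAddCommGroup E] [InnerProductSpace ℝ E]

/-- **The weight identity** `(d+2)·A(τ,z) − ‖z‖²·B(τ,z) = G_τ(z)/(2τ)` (`τ > 0`): the fundamental
theorem of calculus on `[τ, ∞)` for `s ↦ -G_s(z)/(2s)`, whose derivative is
`(d+2) G_s/(4s²) - ‖z‖² G_s/(8s³)` by the caloric time derivative
`∂ₛG_s = (‖z‖²/(4s²) - d/(2s)) G_s`. -/
theorem weightA_weightB_identity {τ : ℝ} (hτ : 0 < τ) (z : E) :
    ((Module.finrank ℝ E : ℝ) + 2) * oseenWeightA τ z - ‖z‖ ^ 2 * oseenWeightB τ z =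
      UnboundedOperators.heatKernel τ z / (2 * τ) := by
  obtain ⟨_, _, hA⟩ := exists_oseenWeightA_le (E := E)
  obtain ⟨_, _, hB⟩ := exists_oseenWeightB_le (E := E)
  have hIA := (hA hτ z).1
  have hIB := (hB hτ z).1
  set d : ℝ := (Module.finrank ℝ E : ℝ) with hd
  set F : ℝ → ℝ := fun s => -(UnboundedOperators.heatKernel s z * (2 * s)⁻¹) with hF
  set F' : ℝ → ℝ := fun s =>
    (d + 2) * (UnboundedOperators.heatKernel s z / (4 * s ^ 2)) -
      ‖z‖ ^ 2 * (UnboundedOperators.heatKernel s z / (8 * s ^ 3)) with hF'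
  have hderiv : ∀ s ∈ Ioi (0:ℝ), HasDerivAt F (F' s) s := by
    intro s hs
    have hs : 0 < s := hs
    have h1 := UnboundedOperators.hasDerivAt_heatKernel_time hs z
    have h2 : HasDerivAt (fun y : ℝ => (2 * y)⁻¹) (-(2 * 1) / (2 * s) ^ 2) s :=
      ((hasDerivAt_id s).const_mul 2).inv (by positivity)
    have h12 := (h1.mul h2).neg
    refine h12.congr_deriv ?_
    simp only [hF', hd]
    field_simp
    ring
  have hderiv' : ∀ s ∈ Ioi τ, HasDerivAt F (F' s) s := fun s hs =>
    hderiv s (lt_trans hτ hs)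
  have hcont : ContinuousWithinAt F (Ici τ) τ :=
    (hderiv τ hτ).continuousAt.continuousWithinAt
  have hint : IntegrableOn F' (Ioi τ) := (hIA.const_mul _).sub (hIB.const_mul _)
  have hlim : Tendsto F atTop (𝓝 0) := by
    have hM : ∀ s, τ ≤ s → UnboundedOperators.heatKernel s z ≤ (4 * Real.pi * τ) ^ (-d / 2) := by
      intro s hs
      have hs0 : 0 < s := lt_of_lt_of_le hτ hs
      refine (UnboundedOperators.heatKernel_le hs0 z).trans ?_
      rw [hd]
      have : (0:ℝ) ≤ (Module.finrank ℝ E : ℝ) := Nat.cast_nonneg _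
      exact Real.rpow_le_rpow_of_nonpos (by positivity) (by nlinarith [Real.pi_pos])
        (by rw [neg_div]; exact neg_nonpos.mpr (by positivity))
    have h0 : Tendsto (fun s : ℝ => (4 * Real.pi * τ) ^ (-d / 2) / (2 * s)) atTop (𝓝 0) :=
      tendsto_const_nhds.div_atTop (tendsto_id.const_mul_atTop (by norm_num : (0:ℝ) < 2))
    refine squeeze_zero_norm' ?_ h0
    filter_upwards [eventually_ge_atTop τ] with s hs
    have hs0 : 0 < s := lt_of_lt_of_le hτ hs
    rw [hF]
    dsimp only
    rw [norm_neg, norm_mul, norm_inv, Real.norm_of_nonneg (UnboundedOperators.heatKernel_pos hs0 z).le,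
      Real.norm_of_nonneg (by positivity : (0:ℝ) ≤ 2 * s), div_eq_mul_inv]
    exact mul_le_mul_of_nonneg_right (hM s hs) (by positivity)
  have hFTC := integral_Ioi_of_hasDerivAt_of_tendsto hcont hderiv' hint hlim
  have hsplit : ∫ s in Ioi τ, F' s = (d + 2) * oseenWeightA τ z - ‖z‖ ^ 2 * oseenWeightB τ z := by
    simp only [hF', oseenWeightA, oseenWeightB]
    rw [integral_sub (hIA.const_mul _) (hIB.const_mul _), integral_const_mul, integral_const_mul]
  rw [← hsplit, hFTC, hF]
  simp only
  field_simp
  ring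

/-- **THE LEVER.  The Oseen kernel is trace-free in its tensor slot**: `∑ᵢ K(τ,z)[eᵢ,eᵢ] = 0`
for every orthonormal basis `(eᵢ)` and `τ > 0` — the kernel form of `P∇·(p·I) = P∇p = 0`.
Consequently the Navier–Stokes nonlinearity `∫ K(σ, x-y)[·] dy` applied to any tensor field is
BLIND to its isotropic part `p(y) I`, for an arbitrary scalar field `p`. -/
theorem sum_oseenKernel_diag_eq_zero {ι : Type*} [Fintype ι] (b : OrthonormalBasis ι ℝ E)
    {τ : ℝ} (hτ : 0 < τ) (z : E) :
    ∑ i, oseenKernel τ z (b i) (b i) = 0 := by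
  set d : ℝ := (Module.finrank ℝ E : ℝ) with hd
  set G := UnboundedOperators.heatKernel τ z
  set A := oseenWeightA τ z
  set B := oseenWeightB τ z
  have h1 : ∑ i, ⟪z, b i⟫ • b i = z := by
    conv_rhs => rw [← b.sum_repr' z]
    exact Finset.sum_congr rfl fun i _ => by rw [real_inner_comm]
  have h2 : ∑ i, ⟪b i, b i⟫ = d := by
    have : ∀ i, ⟪b i, b i⟫ = (1:ℝ) := fun i => by
      rw [real_inner_self_eq_norm_sq, b.orthonormal.1 i, one_pow]
    simp only [this, Finset.sum_const, Finset.card_univ, nsmul_eq_mul, mul_one, hd]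
    rw [Module.finrank_eq_card_basis b.toBasis]
  have h3 : ∑ i, ⟪z, b i⟫ * ⟪z, b i⟫ = ‖z‖ ^ 2 := by
    have := b.sum_inner_mul_inner z z
    simp_rw [real_inner_comm z (b _)] at this
    rw [this, real_inner_self_eq_norm_sq]
  have hsummand : ∀ i, oseenKernel τ z (b i) (b i) =
      (-(G / (2 * τ)) + 2 * A) • (⟪z, b i⟫ • b i) + (A * ⟪b i, b i⟫ - B * (⟪z, b i⟫ * ⟪z, b i⟫)) • z := by
    intro i
    simp only [oseenKernel]
    module
  rw [Finset.sum_congr rfl fun i _ => hsummand i, Finset.sum_add_distrib, ← Finset.smul_sum,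
    ← Finset.sum_smul, h1, Finset.sum_sub_distrib, ← Finset.mul_sum, ← Finset.mul_sum, h2, h3,
    ← add_smul]
  have hw := weightA_weightB_identity hτ z
  have : -(G / (2 * τ)) + 2 * A + (A * d - B * ‖z‖ ^ 2) = 0 := by
    simp only [G, A, B, hd] at hw ⊢; linarith
  rw [this, zero_smul]

end Lever

/-- **Isotropic blindness in a frame**: subtracting an arbitrary multiple of the identity from a
matrix of coefficients does not change its pairing with the kernel frame `K(σ,z)[eⱼ,eₖ]`. -/
theorem sum_sub_diag_smul_oseenKernel {σ : ℝ} (hσ : 0 < σ) (z : E3) (R : Fin 3 → Fin 3 → ℝ)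
    (p : ℝ) :
    ∑ j, ∑ k, (R j k - if j = k then p else 0) • oseenKernel σ z (frame j) (frame k) =
      ∑ j, ∑ k, R j k • oseenKernel σ z (frame j) (frame k) := by
  simp only [sub_smul, Finset.sum_sub_distrib, ite_smul, zero_smul, Finset.sum_ite_eq,
    Finset.mem_univ, if_true]
  rw [← Finset.smul_sum, sum_oseenKernel_diag_eq_zero frame hσ z, smul_zero, sub_zero]

end Summit.NavierStokesRegularity.NavierStokesRegularity.Theorems.ScenarioCensus.DeviatorMeter

end
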